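import Summits.RiemannHypothesis.RiemannHypothesis.Theorems.PfPersistenceAdmissibleClass
import Literature.NumberTheory.LFunctions.WeilGroundEnergyParitySplit
import HarnessLib

/-!
# GAL-0 typed: the Galerkin ↔ continuum form-domain bookkeeping as two named `Prop`s and a proved reduction

pub-rhpf cell, barrier-prover gen 2 (lead §I.5 / INBOX 11:30Z ask: TYPE GAL-0 piece (ii) as a named `Prop`;
piece (i) is owned by cand-3).  Long-odds MECHANISM SEARCH; NO RH CLAIMS.  Everything here is RH-free; the two
named `Prop`s are STATEMENTS (targets), the reduction between them is PROVED.

GAL-0 (CASE-DAG §6) is the Rayleigh–Ritz direction `ε_ev(a) ≤ ε₁^{(N)}(a)`: the bottom Rayleigh quotient of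
`ζ`'s even window block at the window `win = (a, N)` (`bottomRayleigh (zetaDatum win)`, the served
`eps1_even`) is at least the continuum even ground energy `weilEvenGroundEnergy a` (an infimum over SMOOTH even
tests supported in `[-a, a]`).  The Galerkin trial functions are CUT-OFF cosine profiles
`θ_v · 1_{[-a,a]}` (`cutoffProfile`), which are not smooth tests (they jump at `±a`), so the comparison needs
exactly two inputs:

* (i) `GalerkinMatrixIdentity` — the WINDOW-MATRIX IDENTITY: the quadratic form of `ζ`'s even block IS Weil's
  quadratic functional of the cut-off profile, and the coefficient norm IS its `L²` norm (Connes' closed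
  forms `θ_{nm}`, `W_{0,2}`, `W_R`, `W_p` against the Literature functional `weilQuadratic`; cand-3's piece);
* (ii) `CutoffProfileFormDensity` — `C_c^∞`-DENSITY IN THE FORM NORM: every cut-off cosine profile is
  approximated by smooth EVEN tests supported in the same window, simultaneously in `L²` norm and in the value of
  `Re Q` (form-domain analysis of the log-jump form; REFEREE r2 r1-c; the Kolmogorov–Riesz / mollification
  step).  This is the piece typed here at the lead's request.

PROVED: `galerkinRayleighRitz_of_identity_of_density : (i) → (ii) → GalerkinRayleighRitz`, where
`GalerkinRayleighRitz := ∀ win, weilEvenGroundEnergy win.a ≤ bottomRayleigh (zetaDatum win)` is GAL-0 itself,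
and the bookkeeping corollary `galerkin_negative_transfers` (a negative Galerkin Rayleigh quotient at a window
forces a negative continuum even ground energy at that half-length) — the direction in which Galerkin-level
NEGATIVE findings (dials, deletions, plants) are meaningful in the continuum model.  GAL-1 (the opposite
inequality in the limit `N → ∞`) and GAL-2 are not touched.
-/

noncomputable section

open Set MeasureTheory Matrix
open Literature.NumberTheory.LFunctions

namespace Summit.RiemannHypothesis.RiemannHypothesis.Theorems.PfPersistence

/-- The CUT-OFF PROFILE of a coefficient vector at a window: `θ_v(t) = Σ_n v_n ξ_n(t)` on `[-a, a]`
(`profile (2a) v`, Connes' even cosine basis of the window of length `L = 2a`), extended by `0` outside, as a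
complex-valued function on `ℝ` — the Galerkin trial function seen in the continuum model. [folklore] -/
def cutoffProfile (win : Window) (v : Fin (win.N + 1) → ℝ) : ℝ → ℂ :=
  fun t ↦ (((Icc (-win.a) win.a).indicator (profile (2 * win.a) v) t : ℝ) : ℂ)

/-- **GAL-0 piece (i), the WINDOW-MATRIX IDENTITY** (statement; owner cand-3): at every window and for every
coefficient vector, the quadratic form of `ζ`'s even block equals the real part of Weil's quadratic functional
of the cut-off profile, and the coefficient norm equals its `L²` norm (orthonormality of `ξ_n` on the window).
(A `Prop`, statement only.) -/
def GalerkinMatrixIdentity : Prop :=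
  ∀ (win : Window) (v : Fin (win.N + 1) → ℝ),
    v ⬝ᵥ (zetaDatum win *ᵥ v) = (weilQuadratic (cutoffProfile win v)).re ∧
      v ⬝ᵥ v = ∫ t, ‖cutoffProfile win v t‖ ^ 2

/-- **GAL-0 piece (ii), `C_c^∞`-DENSITY IN THE FORM NORM for cut-off cosine profiles** (statement; the piece
the lead asked this seat to type): for every window, coefficient vector and `δ > 0` there is a smooth compactly
supported EVEN test `g` with `tsupport g ⊆ [-a, a]` whose `L²` norm and whose value `Re Q(g)` are both within
`δ` of those of the cut-off profile.  (A `Prop`, statement only; informal route: mollify `θ_v·1_{[-a+η, a-η]}`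
and control the log-jump form across the cut, REFEREE r2 r1-c.) -/
def CutoffProfileFormDensity : Prop :=
  ∀ (win : Window) (v : Fin (win.N + 1) → ℝ) (δ : ℝ), 0 < δ →
    ∃ g : ℝ → ℂ, IsWeilTest g ∧ tsupport g ⊆ Icc (-win.a) win.a ∧ (∀ t, g (-t) = g t) ∧
      |(∫ t, ‖g t‖ ^ 2) - ∫ t, ‖cutoffProfile win v t‖ ^ 2| ≤ δ ∧
      |(weilQuadratic g).re - (weilQuadratic (cutoffProfile win v)).re| ≤ δ

/-- **GAL-0 (Rayleigh–Ritz direction)** as a `Prop`, in HOMOGENEOUS form: at every window and for every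
coefficient vector, `ε_ev(a) · (v ⬝ᵥ v) ≤ v ⬝ᵥ (ζ-block · v)` — i.e. the served bottom Rayleigh quotient of `ζ`'s
even block is at least the continuum even ground energy of the same half-length, `ε_ev(a) ≤ ε₁^{(N)}(a)`
(`weilEvenGroundEnergy_le_bottomRayleigh`).  (A `Prop`, statement only; proved below from (i) and (ii).) -/
def GalerkinRayleighRitz : Prop :=
  ∀ (win : Window) (v : Fin (win.N + 1) → ℝ),
    weilEvenGroundEnergy win.a * (v ⬝ᵥ v) ≤ v ⬝ᵥ (zetaDatum win *ᵥ v)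

/-- PROVED (RH-free): the squared coefficient norm of a nonzero vector is positive. [folklore] -/
theorem dotProduct_self_pos_of_ne_zero {N : ℕ} {v : Fin (N + 1) → ℝ} (hv : v ≠ 0) : 0 < v ⬝ᵥ v :=
  lt_of_le_of_ne (Finset.sum_nonneg fun i _ => mul_self_nonneg (v i))
    fun h => hv (dotProduct_self_eq_zero.1 h.symm)

/-- **PROVED (RH-free): GAL-0 from its two pieces.**  The window-matrix identity (i) and the form-norm density
(ii) give the Rayleigh–Ritz direction at every window: with `g` a smooth even test `δ`-close to the cut-off
profile in norm and in `Re Q`, the homogeneous bound `ε_ev(a)·‖g‖² ≤ Re Q(g)`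
(`weilEvenGroundEnergy_mul_le_re`) passes to the limit `δ → 0`. [folklore] -/
theorem galerkinRayleighRitz_of_identity_of_density (hI : GalerkinMatrixIdentity)
    (hD : CutoffProfileFormDensity) : GalerkinRayleighRitz := by
  intro win v
  refine le_of_forall_pos_lt_add fun ε hε ↦ ?_
  obtain ⟨hQ, hN⟩ := hI win v
  have h1E : 0 < 1 + |weilEvenGroundEnergy win.a| := by positivity
  have hδ0 : 0 < ε / 2 / (1 + |weilEvenGroundEnergy win.a|) := div_pos (half_pos hε) h1E
  have hδε : ε / 2 / (1 + |weilEvenGroundEnergy win.a|) * (1 + |weilEvenGroundEnergy win.a|) = ε / 2 :=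
    div_mul_cancel₀ _ h1E.ne'
  obtain ⟨g, hg, hs, hev, hn, hq⟩ := hD win v _ hδ0
  have hmul := weilEvenGroundEnergy_mul_le_re hg hs hev
  rw [← hN] at hn
  rw [← hQ] at hq
  have h2 : weilEvenGroundEnergy win.a * (v ⬝ᵥ v - ∫ t, ‖g t‖ ^ 2) ≤
      |weilEvenGroundEnergy win.a| * (ε / 2 / (1 + |weilEvenGroundEnergy win.a|)) :=
    calc weilEvenGroundEnergy win.a * (v ⬝ᵥ v - ∫ t, ‖g t‖ ^ 2)
        ≤ |weilEvenGroundEnergy win.a * (v ⬝ᵥ v - ∫ t, ‖g t‖ ^ 2)| := le_abs_self _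
      _ = |weilEvenGroundEnergy win.a| * |v ⬝ᵥ v - ∫ t, ‖g t‖ ^ 2| := abs_mul _ _
      _ ≤ |weilEvenGroundEnergy win.a| * (ε / 2 / (1 + |weilEvenGroundEnergy win.a|)) := by
          apply mul_le_mul_of_nonneg_left _ (abs_nonneg _)
          rwa [abs_sub_comm] at hn
  have hq2 := (abs_le.1 hq).2
  nlinarith [hmul, h2, hq2, hδε, abs_nonneg (weilEvenGroundEnergy win.a)]

/-- PROVED (RH-free): GAL-0 in the served form — `ε_ev(a) ≤ bottomRayleigh (ζ-block at (a, N))`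
(`eps1_even`). [folklore] -/
theorem weilEvenGroundEnergy_le_bottomRayleigh (hG : GalerkinRayleighRitz) (win : Window) :
    weilEvenGroundEnergy win.a ≤ bottomRayleigh (zetaDatum win) := by
  have hne : ({r : ℝ | ∃ v : Fin (win.N + 1) → ℝ, v ≠ 0 ∧
      r = v ⬝ᵥ (zetaDatum win *ᵥ v) / (v ⬝ᵥ v)}).Nonempty := by
    refine ⟨_, fun _ ↦ 1, ?_, rfl⟩
    intro h
    exact one_ne_zero (congr_fun h 0)
  refine le_csInf hne ?_
  rintro r ⟨v, hv, rfl⟩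
  rw [le_div_iff₀ (dotProduct_self_pos_of_ne_zero hv)]
  exact hG win v

/-- **PROVED (RH-free), the bookkeeping direction:** under GAL-0 a NEGATIVE Galerkin Rayleigh quotient of `ζ`'s
even block at a window `(a, N)` forces a negative continuum even ground energy at half-length `a` —
Galerkin-level negative findings (dials, deletions, plants read at `ζ`) are continuum findings. [folklore] -/
theorem weilEvenGroundEnergy_neg_of_form_neg (hG : GalerkinRayleighRitz) (win : Window)
    (v : Fin (win.N + 1) → ℝ) (hneg : v ⬝ᵥ (zetaDatum win *ᵥ v) < 0) :
    weilEvenGroundEnergy win.a < 0 := by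
  have hv : v ≠ 0 := by
    rintro rfl
    simp at hneg
  have hvv := dotProduct_self_pos_of_ne_zero hv
  have h := hG win v
  by_contra hE
  push Not at hE
  have := mul_nonneg hE hvv.le
  linarith

/-- **PROVED (RH-free): under GAL-0 a detectably negative `ζ`-window refutes RH** — the continuum even ground
energy at that half-length is negative, so some smooth even test has `Re Q < 0` (`weilEvenGroundEnergy_nonneg_iff`),
contradicting Weil positivity (`weil_criterion_holds`).  This is the exact sense in which GAL-0 is "direction
bookkeeping for G1.05": it is what a Galerkin sign finding needs to mean anything about `ζ`. [folklore] -/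
theorem not_riemannHypothesis_of_detectablyNegative (hG : GalerkinRayleighRitz)
    (h : DetectablyNegative zetaDatum) : ¬ RiemannHypothesis := by
  obtain ⟨win, v, hneg⟩ := h
  have hE := weilEvenGroundEnergy_neg_of_form_neg hG win v hneg
  intro hRH
  have hW : WeilPositivity := weil_criterion_holds.1 hRH
  have : 0 ≤ weilEvenGroundEnergy win.a :=
    (weilEvenGroundEnergy_nonneg_iff win.a).2 fun g hg _ _ ↦ hW g hg
  linarith

end Summit.RiemannHypothesis.RiemannHypothesis.Theorems.PfPersistence

end
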